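import Summits.AtomisticToContinuum.FouriersLaw.Theorems.BondHeatUncertaintyExtensiveSnapshotIrreversibilityEnergyWindowKernelDuhamelSplit
/-!
# Crux `ExtensiveSnapshotIrreversibility` (stmt-AtomisticToContinuum-9121): the density form of the two half-derivative leaves

Cell decomp-a2c, lens «grading / quantitative ladder», generation 75, part N (critic row 1045 (iii):
«typed against the inventory»).  The infrastructure inventory
(`HOME/decomp-a2c-lens-1/g75/memo/INFRA-INVENTORY-g75.md`) found that the tree PROVES Hörmander's
theorem and the existence of (jointly) smooth transition densities for the Langevin chain
(`OscillatorChain.langevin_transitionDensity_of_hormander` and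
`OscillatorChain.IsConfining.langevin_jointDensity_of_hormander`, namespace
`Literature.MathematicalPhysics.KineticTheory.HeatConduction`), but has no Malliavin / Bismut
objects.  This file therefore moves the two stochastic-analysis leaves of part M one rung DOWN the
ladder, into the language the tree already speaks — weighted `W^{1,1}` bounds on the hypoelliptic
heat kernel `p_t(x, y)` of the pinned chain:

* (G1ᵈ) `DepartureDensityGradientBound` — derivative in the DEPARTURE bath momentum `x_{p_b}`:
  `∫ e^{θH(y)} |∂_{x_{p_b}} p⁰_r(x, y)| dy ≤ C r^{-a} e^{θ₁H(x)}`, `0 < r ≤ 1`, `a < 1`, locally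
  uniformly in the departure point (a domination package, so that one may differentiate under the
  integral sign);  ⟹ (G1) `EqualTemperatureBathGradient` — PROVED here
  (`equalTemperatureBathGradient_of_departureDensityGradient`, dominated differentiation).
* (G1*ᵈ) `ArrivalDensityGradientBound` — derivative in the ARRIVAL bath momentum `y_{p_b}`, uniform
  in the temperature perturbation `|δ| < δ₀`:
  `∫ e^{θ₁H(y)} |∂_{y_{p_b}} p^δ_s(z, y)| dy ≤ C s^{-b} e^{θ₂H(z)}`, `0 < s ≤ 1`, `b < 1`;
  ⟹ (G1*) `PerturbedKernelMomentumIBP` — PROVED here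
  (`perturbedKernelMomentumIBP_of_arrivalDensityGradient`, integration by parts on phase space
  against Lebesgue measure, Mathlib's `integral_mul_fderiv_eq_neg_fderiv_mul_of_integrable`; the
  non-integrable case is the Bochner junk value and holds trivially).
* ★ `kernelTemperatureLipschitz_of_densityGradients : (D) → (G1ᵈ) → (G1*ᵈ) → S3` and the junction
  `K_fix ⟸ A0 ∧ A2 ∧ (D) ∧ (G1ᵈ) ∧ (G1*ᵈ) ∧ A3p ∧ A4` (`snapshotKLUpperExpansion_of_atoms₇N`).

Both density leaves are WEAKER than the summit (finite time, fixed `N`, one kernel; no steady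
state) and STRONGER than the M-leaves they replace only by regularity bookkeeping (given a `C¹`
density, (G1*) for all `C¹` test functions is EQUIVALENT to the weighted `L¹` bound on
`∂_{y_{p_b}} p`, by duality; (G1) for all measurable `|h| ≤ e^{θH}` is the weighted `L¹` bound on
`∂_{x_{p_b}} p` as soon as differentiation under the integral is licensed).  Exponents are RANGES
(`a, b < 1`), never the expected Kolmogorov value `½` (D-0019 4c (iv)); the `θ`-losses are strict.

Why this is novel / where it sits: the weighted (Lyapunov `e^{θH}`) small-time `W^{1,1}` estimates
of the hypoelliptic kernel of a heat-conduction CHAIN in the directly-noised bath directions are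
not in print as such (g74/g75 presearch: corpus fts+vec and galaxy null for chains; nearest in
print: Wang–Zhang 2013 / Guillin–Wang 2012 derivative formulas and gradient estimates for
stochastic Hamiltonian systems with FULL momentum noise and bounded Hessian; Eckmann–Hairer 2000 §3
and Eckmann–Pillet–Rey-Bellet 1999 §3–4: smoothness with energy control but no rates in `t`;
Kusuoka–Stroock 1985/87: local `|∂ p_t| ≲ t^{-ν}` bounds under Hörmander's condition without
weights).  The unbounded Hessian of the quartic interaction is exactly what the weights absorb.

References: N. Cuneo, J.-P. Eckmann, M. Hairer, L. Rey-Bellet, EJP 23 (2018) no. 55, Prop. 3.2,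
§3; F.-Y. Wang, X. Zhang, J. Math. Pures Appl. 99 (2013) 726–740 (arXiv:1107.0096), Thm 1.1;
A. Guillin, F.-Y. Wang, J. Differential Equations 253 (2012) 20–40; J.-P. Eckmann, M. Hairer,
Comm. Math. Phys. 212 (2000) 105–164, §3; J.-P. Eckmann, C.-A. Pillet, L. Rey-Bellet, Comm. Math.
Phys. 201 (1999) 657–697, §3–4; S. Kusuoka, D. Stroock, J. Fac. Sci. Univ. Tokyo 34 (1987)
391–442 (Applications of the Malliavin calculus III), §3.
-/

noncomputable section

namespace Summit.AtomisticToContinuum.FouriersLaw.Theorems.ExtensiveSnapshotIrreversibility.EnergyWindow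

open MeasureTheory ProbabilityTheory Filter Topology Real
open scoped ENNReal NNReal
open Literature.MathematicalPhysics.KineticTheory.HeatConduction
open Literature.Probability.Process

/-! ## 1. The two density leaves -/

/-- **(G1ᵈ) `DepartureDensityGradientBound`** (OPEN · ATTACKABLE-L; WEAKER than the summit): for
positive parameters, `T > 0`, `N ≥ 2` and rates `0 < θ < θ₁ < 1/T` there are an exponent `a < 1`
and `C` such that for every `0 < r ≤ 1` the equal-temperature kernel `P^0_r(x, dy)` has a
nonnegative measurable Lebesgue density `p(x, y)` with `∫ e^{θH(y)} p(x, y) dy < ∞`, and for both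
bath sites `b` and every departure point `w`, along the line `t ↦ w[p_b := t]` near `w_{p_b}` the
density is differentiable in `t` with derivative `p'(t, y)` dominated by some `F(y)`,
`∫ e^{θH(y)} F(y) dy ≤ C r^{-a} e^{θ₁H(w)}` (expected `a = ½`: the Kolmogorov scaling of a
directly-noised direction). (after WangZhang2013degenerate, Thm 1.1)
(after EckmannHairer2000, §3) (after CuneoEckmannHairerReyBellet2018, Prop 3.2) [route leaf · named hypothesis of this cell, NOT filed as a literature fact] -/
def DepartureDensityGradientBound : Prop :=
  ∀ ω₂ lam β γ : ℝ, 0 < ω₂ → 0 < lam → 0 < β → 0 < γ →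
    ∀ T : ℝ, 0 < T → ∀ (N : ℕ) (hN : 2 ≤ N), ∀ θ θ₁ : ℝ, 0 < θ → θ < θ₁ → θ₁ < 1 / T →
      ∃ a C : ℝ, a < 1 ∧ ∀ r : ℝ, 0 < r → r ≤ 1 →
        ∃ p : PhaseSpace N → PhaseSpace N → ℝ,
          (∀ w, Measurable (p w)) ∧ (∀ w y, 0 ≤ p w y) ∧
          (∀ w, (pinnedChain ω₂ lam β γ).transitionKernel N T T r.toNNReal w =
              volume.withDensity fun y => ENNReal.ofReal (p w y)) ∧
          (∀ w, Integrable fun y =>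
              Real.exp (θ * (pinnedChain ω₂ lam β γ).hamiltonian N y) * p w y) ∧
          ∀ b : Fin N, (b = leftBath N hN ∨ b = rightBath N hN) → ∀ w : PhaseSpace N,
            ∃ ε : ℝ, 0 < ε ∧ ∃ (p' : ℝ → PhaseSpace N → ℝ) (F : PhaseSpace N → ℝ),
              (∀ t : ℝ, |t - w.2 b| < ε → ∀ y,
                  HasDerivAt (fun τ => p (w.1, Function.update w.2 b τ) y) (p' t y) t) ∧
              (∀ t : ℝ, |t - w.2 b| < ε → ∀ y, |p' t y| ≤ F y) ∧
              Measurable (p' (w.2 b)) ∧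
              Integrable (fun y =>
                Real.exp (θ * (pinnedChain ω₂ lam β γ).hamiltonian N y) * F y) ∧
              ∫ y, Real.exp (θ * (pinnedChain ω₂ lam β γ).hamiltonian N y) * F y ≤
                C * r ^ (-a) * Real.exp (θ₁ * (pinnedChain ω₂ lam β γ).hamiltonian N w)

/-- **(G1*ᵈ) `ArrivalDensityGradientBound`** (OPEN · ATTACKABLE-L; WEAKER than the summit): for
positive parameters, `T > 0`, `N ≥ 2` and rates `0 < θ₁ < θ₂ < 1/T` there are an exponent
`b₀ < 1`, `δ₀ > 0` and `C` such that for `|δ| < δ₀`, `0 < s ≤ 1` and every `z` the two-temperature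
kernel `P^δ_s(z, dy)` (baths `T ± δ/2`) has a nonnegative `C¹` Lebesgue density `p(y)` with
`∫ e^{θ₁H} p < ∞` and, for both bath sites `b`,
`∫ e^{θ₁H(y)} |∂_{p_b} p(y)| dy ≤ C s^{-b₀} e^{θ₂H(z)}` (expected `b₀ = ½`; the Malliavin
integration-by-parts weight is `−∂_{p_b} log p (Z_s)`). (after KusuokaStroock1987, §3)
(after EckmannHairer2000, §3) (after CuneoEckmannHairerReyBellet2018, Prop 3.2) [route leaf · named hypothesis of this cell, NOT filed as a literature fact] -/
def ArrivalDensityGradientBound : Prop :=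
  ∀ ω₂ lam β γ : ℝ, 0 < ω₂ → 0 < lam → 0 < β → 0 < γ →
    ∀ T : ℝ, 0 < T → ∀ (N : ℕ) (hN : 2 ≤ N), ∀ θ₁ θ₂ : ℝ, 0 < θ₁ → θ₁ < θ₂ → θ₂ < 1 / T →
      ∃ b₀ δ₀ C : ℝ, b₀ < 1 ∧ 0 < δ₀ ∧ ∀ δ : ℝ, |δ| < δ₀ →
        ∀ s : ℝ, 0 < s → s ≤ 1 → ∀ z : PhaseSpace N,
          ∃ p : PhaseSpace N → ℝ, ContDiff ℝ 1 p ∧ (∀ y, 0 ≤ p y) ∧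
            pertKernel ω₂ lam β γ T δ N s z = volume.withDensity (fun y => ENNReal.ofReal (p y)) ∧
            Integrable (fun y =>
              Real.exp (θ₁ * (pinnedChain ω₂ lam β γ).hamiltonian N y) * p y) ∧
            ∀ b : Fin N, (b = leftBath N hN ∨ b = rightBath N hN) →
              Integrable (fun y =>
                Real.exp (θ₁ * (pinnedChain ω₂ lam β γ).hamiltonian N y) * |partialP b p y|) ∧
              ∫ y, Real.exp (θ₁ * (pinnedChain ω₂ lam β γ).hamiltonian N y) * |partialP b p y| ≤
                C * s ^ (-b₀) * Real.exp (θ₂ * (pinnedChain ω₂ lam β γ).hamiltonian N z)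

/-! ## 2. Integrals against a kernel with a Lebesgue density -/

/-- `∫ f d(vol.withDensity p) = ∫ p · f dvol` for a nonnegative measurable real density (no
integrability needed: both sides take the same junk value). [folklore] -/
theorem integral_withDensity_ofReal_phaseSpace {N : ℕ} {p : PhaseSpace N → ℝ} (hp : Measurable p)
    (hp0 : ∀ y, 0 ≤ p y) (f : PhaseSpace N → ℝ) :
    ∫ y, f y ∂(volume.withDensity fun y => ENNReal.ofReal (p y)) = ∫ y, p y * f y := by
  rw [show (volume.withDensity fun y => ENNReal.ofReal (p y)) =
      volume.withDensity (fun y => ((fun y => (p y).toNNReal) y : ℝ≥0∞)) from rfl,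
    integral_withDensity_eq_integral_smul hp.real_toNNReal]
  refine integral_congr_ae (Eventually.of_forall fun y => ?_)
  show (p y).toNNReal • f y = p y * f y
  rw [NNReal.smul_def, Real.coe_toNNReal _ (hp0 y), smul_eq_mul]

/-! ## 3. (G1*ᵈ) ⟹ (G1*): integration by parts on phase space -/

/-- **The arrival-density gradient bound implies the perturbed-kernel integration by parts
estimate.** For `g ∈ C¹` with `|g| ≤ M e^{θ₁H}`: if `p ∂_{p_b} g` is Lebesgue-integrable,
`∫ ∂_{p_b} g · p = −∫ g · ∂_{p_b} p` (no boundary terms on the whole space, all three products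
integrable) and `|∫ g ∂_{p_b} p| ≤ M ∫ e^{θ₁H} |∂_{p_b} p| ≤ M C s^{-b₀} e^{θ₂H(z)}`; otherwise the
Bochner integral vanishes. [folklore] -/
theorem perturbedKernelMomentumIBP_of_arrivalDensityGradient
    (hA : ArrivalDensityGradientBound) : PerturbedKernelMomentumIBP := by
  intro ω₂ lam β γ hω hl hβ hγ T hT N hN θ₁ θ₂ hθ₁ hθ₁₂ hθ₂
  obtain ⟨b₀, δ₀, C, hb₀, hδ₀, hmain⟩ := hA ω₂ lam β γ hω hl hβ hγ T hT N hN θ₁ θ₂ hθ₁ hθ₁₂ hθ₂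
  refine ⟨b₀, δ₀, C, hb₀, hδ₀, fun δ hδ s hs0 hs1 b hb M hM g hg hgM z => ?_⟩
  obtain ⟨p, hpC, hp0, hker, hintp, hgrad⟩ := hmain δ hδ s hs0 hs1 z
  obtain ⟨hintd, hbound⟩ := hgrad b hb
  haveI := isAddHaarMeasure_volume_phaseSpace N
  have hpd : Differentiable ℝ p := hpC.differentiable one_ne_zero
  have hgd : Differentiable ℝ g := hg.differentiable one_ne_zero
  have hE : ∀ w : PhaseSpace N,
      0 < Real.exp (θ₁ * (pinnedChain ω₂ lam β γ).hamiltonian N w) := fun w => Real.exp_pos _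
  have hEz : 0 < Real.exp (θ₂ * (pinnedChain ω₂ lam β γ).hamiltonian N z) := Real.exp_pos _
  have hsb : 0 < s ^ (-b₀) := Real.rpow_pos_of_pos hs0 _
  have hI0 : 0 ≤ ∫ y, Real.exp (θ₁ * (pinnedChain ω₂ lam β γ).hamiltonian N y) * |partialP b p y| :=
    integral_nonneg fun y => mul_nonneg (hE y).le (abs_nonneg _)
  have hC : 0 ≤ C := by
    by_contra h
    rw [not_le] at h
    have h1 : C * s ^ (-b₀) * Real.exp (θ₂ * (pinnedChain ω₂ lam β γ).hamiltonian N z) < 0 :=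
      mul_neg_of_neg_of_pos (mul_neg_of_neg_of_pos h hsb) hEz
    linarith
  rw [hker, integral_withDensity_ofReal_phaseSpace hpC.continuous.measurable hp0]
  -- the coordinate derivatives as Fréchet derivatives along `v = (0, e_b)`
  set v : PhaseSpace N := ((0, Pi.single b 1) : PhaseSpace N) with hv
  have hpg : ∀ w, partialP b g w = fderiv ℝ g w v := fun w => by rw [partialP_eq_fderiv hgd]
  have hpp : ∀ w, partialP b p w = fderiv ℝ p w v := fun w => by rw [partialP_eq_fderiv hpd]
  have hcont_dp : Continuous fun w => fderiv ℝ p w v :=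
    (hpC.continuous_fderiv one_ne_zero).clm_apply continuous_const
  have hcont_dg : Continuous fun w => fderiv ℝ g w v :=
    (hg.continuous_fderiv one_ne_zero).clm_apply continuous_const
  -- integrability of `∂p · g` and `p · g` from the weighted bounds
  have hf'g : Integrable (fun w => fderiv ℝ p w v * g w) := by
    refine Integrable.mono' (hintd.const_mul M) (hcont_dp.mul hg.continuous).aestronglyMeasurable
      (Eventually.of_forall fun w => ?_)
    rw [Real.norm_eq_abs, abs_mul, ← hpp w]
    calc |partialP b p w| * |g w|
        ≤ |partialP b p w| * (M * Real.exp (θ₁ * (pinnedChain ω₂ lam β γ).hamiltonian N w)) :=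
          mul_le_mul_of_nonneg_left (hgM w) (abs_nonneg _)
      _ = M * (Real.exp (θ₁ * (pinnedChain ω₂ lam β γ).hamiltonian N w) *
          |partialP b p w|) := by
          ring
  have hfg : Integrable (fun w => p w * g w) := by
    refine Integrable.mono' (hintp.const_mul M)
      (hpC.continuous.mul hg.continuous).aestronglyMeasurable
      (Eventually.of_forall fun w => ?_)
    rw [Real.norm_eq_abs, abs_mul, abs_of_nonneg (hp0 w)]
    calc p w * |g w|
        ≤ p w * (M * Real.exp (θ₁ * (pinnedChain ω₂ lam β γ).hamiltonian N w)) :=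
          mul_le_mul_of_nonneg_left (hgM w) (hp0 w)
      _ = M * (Real.exp (θ₁ * (pinnedChain ω₂ lam β γ).hamiltonian N w) * p w) := by ring
  by_cases hint : Integrable (fun w => p w * partialP b g w)
  · have hint' : Integrable (fun w => p w * fderiv ℝ g w v) := by
      refine hint.congr (Eventually.of_forall fun w => ?_)
      show p w * partialP b g w = p w * fderiv ℝ g w v
      rw [hpg w]
    have hibp := integral_mul_fderiv_eq_neg_fderiv_mul_of_integrable
      (μ := (volume : Measure (PhaseSpace N)))
      hf'g hint' hfg (fun w _ => hpd w) (fun w _ => hgd w)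
    have hre : ∫ w, p w * partialP b g w = ∫ w, p w * fderiv ℝ g w v :=
      integral_congr_ae (Eventually.of_forall fun w => by
        show p w * partialP b g w = p w * fderiv ℝ g w v
        rw [hpg w])
    rw [hre, hibp, abs_neg]
    calc |∫ w, fderiv ℝ p w v * g w|
        ≤ ∫ w, |fderiv ℝ p w v * g w| := abs_integral_le_integral_abs
      _ ≤ ∫ w, M * (Real.exp (θ₁ * (pinnedChain ω₂ lam β γ).hamiltonian N w) *
          |partialP b p w|) := by
          refine integral_mono hf'g.abs (hintd.const_mul M) fun w => ?_
          show |fderiv ℝ p w v * g w| ≤ _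
          rw [abs_mul, ← hpp w]
          calc |partialP b p w| * |g w|
              ≤ |partialP b p w| * (M * Real.exp (θ₁ * (pinnedChain ω₂ lam β γ).hamiltonian N w)) :=
                mul_le_mul_of_nonneg_left (hgM w) (abs_nonneg _)
            _ = M * (Real.exp (θ₁ * (pinnedChain ω₂ lam β γ).hamiltonian N w) *
                |partialP b p w|) := by
                ring
      _ = M * ∫ w, Real.exp (θ₁ * (pinnedChain ω₂ lam β γ).hamiltonian N w) * |partialP b p w| :=
          integral_const_mul _ _
      _ ≤ M * (C * s ^ (-b₀) * Real.exp (θ₂ * (pinnedChain ω₂ lam β γ).hamiltonian N z)) :=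
          mul_le_mul_of_nonneg_left hbound hM
      _ = C * s ^ (-b₀) * M * Real.exp (θ₂ * (pinnedChain ω₂ lam β γ).hamiltonian N z) := by ring
  · rw [integral_undef hint, abs_zero]
    exact mul_nonneg (mul_nonneg (mul_nonneg hC hsb.le) hM) hEz.le

/-! ## 4. (G1ᵈ) ⟹ (G1): differentiation under the integral sign -/

/-- **The departure-density gradient bound implies the equal-temperature bath-gradient
estimate.** `∂_{p_b} P^0_r h(w) = d/dt ∫ p(w[p_b := t], y) h(y) dy |_{t = w_{p_b}}
= ∫ p'(w_{p_b}, y) h(y) dy` by dominated differentiation (domination `e^{θH} F`), and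
`|∫ p' h| ≤ ∫ e^{θH} F ≤ C r^{-a} e^{θ₁H(w)}`. [folklore] -/
theorem equalTemperatureBathGradient_of_departureDensityGradient
    (hG : DepartureDensityGradientBound) : EqualTemperatureBathGradient := by
  intro ω₂ lam β γ hω hl hβ hγ T hT N hN θ θ₁ hθ hθθ₁ hθ₁
  obtain ⟨a, C, ha, hmain⟩ := hG ω₂ lam β γ hω hl hβ hγ T hT N hN θ θ₁ hθ hθθ₁ hθ₁
  refine ⟨a, C, ha, fun r hr0 hr1 h hh hhθ b hb w => ?_⟩
  obtain ⟨p, hpm, hp0, hker, hintp, hgrad⟩ := hmain r hr0 hr1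
  obtain ⟨ε, hε, p', F, hder, hdom, hp'm, hintF, hbound⟩ := hgrad b hb w
  have hE : ∀ y : PhaseSpace N,
      0 < Real.exp (θ * (pinnedChain ω₂ lam β γ).hamiltonian N y) := fun y => Real.exp_pos _
  -- the kernel applied to `h` along the line `t ↦ w[p_b := t]`
  have hfun : (fun t : ℝ => eqKernelFun ω₂ lam β γ T N h r (w.1, Function.update w.2 b t)) =
      fun t => ∫ y, p (w.1, Function.update w.2 b t) y * h y := by
    funext t
    unfold eqKernelFun
    rw [hker, integral_withDensity_ofReal_phaseSpace (hpm _) (hp0 _)]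
  have hw : ((w.1, Function.update w.2 b (w.2 b)) : PhaseSpace N) = w := by
    rw [Function.update_eq_self]
  -- dominated differentiation at `t = w_{p_b}`
  have hkey := hasDerivAt_integral_of_dominated_loc_of_deriv_le
    (μ := (volume : Measure (PhaseSpace N)))
    (F := fun t y => p (w.1, Function.update w.2 b t) y * h y)
    (F' := fun t y => p' t y * h y) (x₀ := w.2 b)
    (bound := fun y => Real.exp (θ * (pinnedChain ω₂ lam β γ).hamiltonian N y) * F y)
    (s := Metric.ball (w.2 b) ε) (Metric.ball_mem_nhds _ hε)
    (Eventually.of_forall fun t => ((hpm _).mul hh).aestronglyMeasurable)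
    (by
      rw [hw]
      refine Integrable.mono' (hintp w) ((hpm w).mul hh).aestronglyMeasurable
        (Eventually.of_forall fun y => ?_)
      rw [Real.norm_eq_abs, abs_mul, abs_of_nonneg (hp0 w y), mul_comm]
      exact mul_le_mul_of_nonneg_right (hhθ y) (hp0 w y))
    ((hp'm.mul hh).aestronglyMeasurable)
    (Eventually.of_forall fun y t ht => by
      rw [Metric.mem_ball, Real.dist_eq] at ht
      rw [Real.norm_eq_abs, abs_mul, mul_comm]
      exact mul_le_mul (hhθ y) (hdom t ht y) (abs_nonneg _) (hE y).le)
    hintF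
    (Eventually.of_forall fun y t ht => by
      rw [Metric.mem_ball, Real.dist_eq] at ht
      exact (hder t ht y).mul_const (h y))
  obtain ⟨hint', hderiv⟩ := hkey
  have hval : partialP b (eqKernelFun ω₂ lam β γ T N h r) w = ∫ y, p' (w.2 b) y * h y := by
    unfold partialP
    rw [hfun]
    exact hderiv.deriv
  have h0 : |w.2 b - w.2 b| < ε := by simpa using hε
  rw [hval]
  calc |∫ y, p' (w.2 b) y * h y|
      ≤ ∫ y, |p' (w.2 b) y * h y| := abs_integral_le_integral_abs
    _ ≤ ∫ y, Real.exp (θ * (pinnedChain ω₂ lam β γ).hamiltonian N y) * F y := by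
        refine integral_mono hint'.abs hintF fun y => ?_
        show |p' (w.2 b) y * h y| ≤ _
        rw [abs_mul, mul_comm]
        exact mul_le_mul (hhθ y) (hdom _ h0 y) (abs_nonneg _) (hE y).le
    _ ≤ C * r ^ (-a) * Real.exp (θ₁ * (pinnedChain ω₂ lam β γ).hamiltonian N w) := hbound

/-! ## 5. The junction through the density leaves -/

/-- ★ **`S3 ⟸ (D) ∧ (G1ᵈ) ∧ (G1*ᵈ)`**: the split Duhamel formula of part M fed by the two
density-gradient bounds. [folklore] -/
theorem kernelTemperatureLipschitz_of_densityGradients (hD : KernelTemperatureDuhamel)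
    (hG : DepartureDensityGradientBound) (hA : ArrivalDensityGradientBound) :
    KernelTemperatureLipschitz :=
  kernelTemperatureLipschitz_of_duhamelSplit hD
    (equalTemperatureBathGradient_of_departureDensityGradient hG)
    (perturbedKernelMomentumIBP_of_arrivalDensityGradient hA)

/-- **Glue `A0 → A2 → (D) → (G1ᵈ) → (G1*ᵈ) → A3p → A4 → (W)`.** [folklore] -/
theorem energyWindowControl_of_atoms₇N (h0 : NessGibbsReweighting) (h2 : NessOddLogRatioBound)
    (hD : KernelTemperatureDuhamel) (hG : DepartureDensityGradientBound)
    (hA : ArrivalDensityGradientBound) (h3p : NessFloorMeanValue) (h4 : NessLinearResponseL2) :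
    EnergyWindowControl :=
  energyWindowControl_of_atoms₅K h0 h2 (kernelTemperatureLipschitz_of_densityGradients hD hG hA)
    h3p h4

/-- ★ **The junction `K_fix ⟸ A0 ∧ A2 ∧ (D) ∧ (G1ᵈ) ∧ (G1*ᵈ) ∧ A3p ∧ A4`.** [folklore] -/
theorem snapshotKLUpperExpansion_of_atoms₇N (h0 : NessGibbsReweighting)
    (h2 : NessOddLogRatioBound) (hD : KernelTemperatureDuhamel)
    (hG : DepartureDensityGradientBound) (hA : ArrivalDensityGradientBound)
    (h3p : NessFloorMeanValue) (h4 : NessLinearResponseL2) : SnapshotKLUpperExpansion :=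
  snapshotKLUpperExpansion_of_atoms₅K h0 h2
    (kernelTemperatureLipschitz_of_densityGradients hD hG hA) h3p h4

end Summit.AtomisticToContinuum.FouriersLaw.Theorems.ExtensiveSnapshotIrreversibility.EnergyWindow

end
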